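import Mathlib
import HarnessLib.Audit
import Summits.PneNP.PneNP.Theorems.PstarCrossCaseU2Touch
import Summits.PneNP.PneNP.Theorems.PstarNorUnitExcCore

/-!
# The blind free CROSS gate: a chord whose level set `{u_{e₁} = 1}` is a constraint level has NO companion chord above it (O2 / E1; prover-1 g23)

FRONTIER range-avoidance ladder, rung F-N3 (`stmt-PneNP-19007`), cell `pnp-ideate`; restricted-model proof complexity — nothing here bears on `P` versus `NP`.

The regime-independent core of `PstarCrossCaseTEqUnique.caseT_eq_no_other`.  Cross data `B`, a chord `e₁` with `q_{mv} + κ = u_{e₁}` for some direction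
`mv` (the (EQ) chord of regime T, `q_m = u_{e₁}`; of regime P, `q_{(1,0)} = u_{e₁} + 1`), and another chord `e₂` with `{u_{e₁} = 1} ⊆ {u_{e₂} = 1}`
(regime T: `PstarCrossCaseT.forcing_of_real`; regime P: `PstarCrossCaseP.u_of_q`).  Then:

* `u_{e₂} + u_{e₁} = μ₁μ₂` (`PstarCrossCaseU2Touch.clean_or_nondeg` against `u_{e₂}`; the other rows are `u_{e₁} ≡ 0`, `D e₂ = D e₁`, rank two);
* this is an (EXC) relation `Q_{D e₂} = q + μ₁μ₂ + κ'` for `q := u_{e₁} + 1 = q_{mv} + κ + 1`, whose polar form IS `polarDir mv` (`polarDir_eq_of_level`) and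
  whose zero set lies in `{Q_{D e₂} = γ₂ + 1}` — so the CLEAN theory's `PstarNorUnitExcCore.exc_unit_core` applies verbatim: (EQ) gives `D e₂ = D e₁`
  (`chord_eq_of_EQ`); the UNIT alternative (`D e₂ = {j₁, j₂}`, linear parts on one literal `σ` of `j₁` and one `τ` of `j₂`, polar formula
  `[v ~ w in D e₁] = [v ~ w in D e₂] + [{v,w} = {σ,τ}]`) dies by evaluating `u_{e₂} + u_{e₁} = μ₁μ₂` at `0, e_σ, e_τ, e_σ+e_τ, e_σ+e_τ+e_{σ'}`.
* **`no_companion`** — contradiction.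
-/

set_option linter.dupNamespace false -- `Summit.PneNP.PneNP.…`: summit = sub-problem name (D-0017 single-conjunct layout)

open Finset Module Literature.Computability.Complexity
open Summit.PneNP.PneNP.Theorems.PstarTyped (Typed)
open Summit.PneNP.PneNP.Theorems.PstarSALevel (varSet BoundaryExpanding SimpleOverlap)
open Summit.PneNP.PneNP.Theorems.PstarGapLinearised (andPair)
open Summit.PneNP.PneNP.Theorems.PstarChordEndgameTools (mem_andPair_iff)
open Summit.PneNP.PneNP.Theorems.PstarCubeIdeals (IsAffineFn IsQuadFn)
open Summit.PneNP.PneNP.Theorems.PstarProductRank (qform polar)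
open Summit.PneNP.PneNP.Theorems.PstarPathRank (AndAdj polar_basis and_ne)
open Summit.PneNP.PneNP.Theorems.PstarReadSumset (V2)
open Summit.PneNP.PneNP.Theorems.PstarForcing (polar_unique exists_ne_of_rank_four not_rank_four_of_mul)
open Summit.PneNP.PneNP.Theorems.PstarChordSystem (ChordSystem)
open Summit.PneNP.PneNP.Theorems.PstarChordBridgeTools
open Summit.PneNP.PneNP.Theorems.PstarChordBridge
open Summit.PneNP.PneNP.Theorems.PstarChordBridgeForcing (freeMon gam sys_u_eq qform_add' rank_four_of_wf chord_eq_of_EQ)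
open Summit.PneNP.PneNP.Theorems.PstarChordBridgeBasis (qDir polarDir)
open Summit.PneNP.PneNP.Theorems.PstarChordBridgeCorner (qDir_add)
open Summit.PneNP.PneNP.Theorems.PstarCrossData (CrossData)
open Summit.PneNP.PneNP.Theorems.PstarCrossSystem
open Summit.PneNP.PneNP.Theorems.PstarCrossCaseU2 (u_add)
open Summit.PneNP.PneNP.Theorems.PstarCrossCaseU2Touch (card_J₀_le clean_or_nondeg)
open Summit.PneNP.PneNP.Theorems.PstarNorUnitExcCore (exc_unit_core)

namespace Summit.PneNP.PneNP.Theorems.PstarCrossNoCompanion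

variable {n m : ℕ}

section

variable (I : LocalMap 4 n m) {r : ℕ} {B : BridgeData n m} {e_p e_q g₀ : Fin m}

/-- `q_{mv} + κ` satisfies the polar identity with `polarDir`. -/
theorem isQuadFn_shift (B : BridgeData n m) (mv : V2) (κ : ZMod 2) (x w : Fin n → ZMod 2) :
    qDir I B mv (x + w) + κ = qDir I B mv x + κ + (qDir I B mv w + κ) + (qDir I B mv 0 + κ) + polarDir I B mv x w := by
  rw [qDir_add I B mv x w]
  generalize qDir I B mv x = a; generalize qDir I B mv w = b; generalize qDir I B mv 0 = c; generalize polarDir I B mv x w = d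
  revert a b c d κ; decide

/-- **If a constraint's state-free part is `u_{e₁}` up to a constant, its polar form is `polar(Q_{D e₁})`.** -/
theorem polarDir_eq_of_level {mv : V2} {κ : ZMod 2} {e₁ : Fin m} (hq : ∀ x, qDir I B mv x + κ = (sys I B).u e₁ x) :
    polarDir I B mv = polar (B.D e₁) (fun j => I.vars j 2) (fun j => I.vars j 3) := by
  refine polar_unique (Q := fun x => qDir I B mv x + κ) (isQuadFn_shift I B mv κ) fun x w => ?_
  show qDir I B mv (x + w) + κ = qDir I B mv x + κ + (qDir I B mv w + κ) + (qDir I B mv 0 + κ) + _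
  rw [hq, hq, hq, hq]
  exact u_add I B e₁ x w

/-- **A chord whose level set is a constraint level has no companion above it.**  If `q_{mv} + κ = u_{e₁}` for a chord `e₁` and another chord `e₂`
satisfies `{u_{e₁} = 1} ⊆ {u_{e₂} = 1}`, contradiction.  (`u_{e₂} + u_{e₁}` is then a product of affine functions — `PstarCrossCaseU2Touch.clean_or_nondeg`
against `u_{e₂}` — and `Q_{D e₂} = q + μ₁μ₂ + κ'` for `q := u_{e₁} + 1`, whose polar form is `polarDir mv`: `PstarNorUnitExcCore.exc_unit_core` leaves
(EQ), i.e. `D e₂ = D e₁`, or a unit `D e₂ = {j₁, j₂}` with the polar formula, killed by five point evaluations.) -/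
theorem no_companion (hI : I.IsPure xorAndPred) (hS : SimpleOverlap I) (hB : BoundaryExpanding r I) (hD : CrossData I r B e_p e_q g₀)
    {mv : V2} {κ : ZMod 2} {e₁ : Fin m} (he₁N : e₁ ∈ B.N) (hq : ∀ x, qDir I B mv x + κ = (sys I B).u e₁ x)
    {e₂ : Fin m} (he₂N : e₂ ∈ B.N) (hne : e₂ ≠ e₁) (hu₂ : ∀ x, (sys I B).u e₁ x = 1 → (sys I B).u e₂ x = 1) : False := by
  classical
  have hW := hD.wf
  have he₂J : e₂ ∈ B.J₀ := hW.hN he₂N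
  have e01 : ∀ t : ZMod 2, t = 0 ∨ t = 1 := by decide
  have hrank₁ := rank_four_of_wf I hI hS hB hW (card_J₀_le I hD) he₁N
  -- `u_{e₂} + u_{e₁}` is a product of affine functions
  obtain ⟨μ₁, μ₂, h₁, h₂, hP⟩ : ∃ μ₁ μ₂ : (Fin n → ZMod 2) → ZMod 2, IsAffineFn μ₁ ∧ IsAffineFn μ₂ ∧
      ∀ x, (sys I B).u e₂ x + (sys I B).u e₁ x = μ₁ x * μ₂ x := by
    have hZ' : ∀ x, (sys I B).u e₂ x = 0 → (sys I B).u e₁ x = 0 := fun x hx => by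
      rcases e01 ((sys I B).u e₁ x) with h0 | h1
      · exact h0
      · have h := hu₂ x h1
        rw [hx] at h
        exact absurd h zero_ne_one
    have hg : IsQuadFn ((sys I B).u e₁) := ⟨polar (B.D e₁) (fun j => I.vars j 2) (fun j => I.vars j 3), u_add I B e₁⟩
    rcases clean_or_nondeg I hI hS hB hD he₂N hg hZ' with (h0 | hu) | ⟨μ₁, μ₂, h₁, h₂, -, -, -, hrow⟩
    · exfalso
      obtain ⟨v, hv⟩ := exists_ne_of_rank_four (u_add I B e₁) hrank₁
      exact hv (by rw [h0 v, h0 0])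
    · exfalso
      refine hne (chord_eq_of_EQ I hI hS hW (q := qform (B.D e₁) (fun j => I.vars j 2) (fun j => I.vars j 3)) he₂N he₁N
        (κ := gam B e₁ + gam B e₂) (κ' := 0) (fun x => ?_) (fun x => by rw [add_zero]))
      have h := hu x
      rw [sys_u_eq, sys_u_eq] at h
      have e : ∀ g₁ q₁ g₂ q₂ : ZMod 2, g₁ + q₁ = g₂ + q₂ → q₂ = q₁ + (g₁ + g₂) := by decide
      exact e _ _ _ _ h
    · rcases hrow with h | h
      · exfalso
        exact not_rank_four_of_mul (u_add I B e₁) h₁ h₂ (κ := 0) (fun x => by rw [add_zero]; exact h x) hrank₁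
      · exact ⟨μ₁, μ₂, h₁, h₂, h⟩
  -- the (EXC) data for `exc_unit_core` with `q := u_{e₁} + 1 = q_{mv} + κ + 1`
  set q : (Fin n → ZMod 2) → ZMod 2 := fun x => qDir I B mv x + (κ + 1) with hqdef
  have hqB : ∀ x w, q (x + w) = q x + q w + q 0 + polarDir I B mv x w := fun x w => isQuadFn_shift I B mv (κ + 1) x w
  have hq1 : ∀ x, q x = (sys I B).u e₁ x + 1 := fun x => by
    simp only [hqdef]; rw [← hq x, add_assoc]
  have hZ : ∀ x, q x = 0 → qform (B.D e₂) (fun j => I.vars j 2) (fun j => I.vars j 3) x = 1 + gam B e₂ := fun x hx => by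
    have hx1 : (sys I B).u e₁ x = 1 := by
      rw [hq1 x] at hx
      have e : ∀ a : ZMod 2, a + 1 = 0 → a = 1 := by decide
      exact e _ hx
    have h := hu₂ x hx1
    rw [sys_u_eq] at h
    have e : ∀ g Q : ZMod 2, g + Q = 1 → Q = 1 + g := by decide
    exact e _ _ h
  have hEXC : ∀ x, qform (B.D e₂) (fun j => I.vars j 2) (fun j => I.vars j 3) x = q x + μ₁ x * μ₂ x + (1 + gam B e₂) := fun x => by
    have h := hP x
    rw [sys_u_eq I B e₂] at h
    rw [hq1 x]
    have e : ∀ g₂ Q₂ u₁ P : ZMod 2, g₂ + Q₂ + u₁ = P → Q₂ = u₁ + 1 + P + (1 + g₂) := by decide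
    exact e _ _ _ _ h
  have hr : (B.J₀ ∪ B.G₁ ∪ B.G₂).card ≤ r := by
    refine le_trans (card_le_card ?_) hD.rad
    exact union_subset_union (union_subset_union subset_rfl (subset_insert g₀ B.G₁)) subset_rfl
  have hd₁ : Disjoint B.G₁ B.J₀ := Finset.disjoint_of_subset_left (subset_insert g₀ B.G₁) hD.disj₁
  have heG : e₂ ∉ B.G₁ ∪ B.G₂ := by
    rw [mem_union, not_or]
    exact ⟨fun h => Finset.disjoint_left.1 hd₁ h he₂J, fun h => Finset.disjoint_left.1 hD.disj₂ h he₂J⟩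
  rcases exc_unit_core I hI hS hB hW hr he₂N heG mv hqB hZ h₁ h₂ hEXC with ⟨κ', hEQ⟩ | ⟨j₁, j₂, σ, τ, hj12, hDe₂, hdisj, hσ, hτ, hsupp, hpolar, -⟩
  · -- (EQ) for `e₂` against `q`: `D e₂ = D e₁`, so `e₂ = e₁`
    refine hne (chord_eq_of_EQ I hI hS hW (q := qform (B.D e₁) (fun j => I.vars j 2) (fun j => I.vars j 3)) he₂N he₁N
      (κ := κ' + 1 + gam B e₁) (κ' := 0) (fun x => ?_) (fun x => by rw [add_zero]))
    rw [hEQ x, hq1 x, sys_u_eq]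
    have e : ∀ g a k : ZMod 2, g + a + 1 + k = a + (k + 1 + g) := by decide
    exact e _ _ _
  · -- UNIT: `D e₂ = {j₁, j₂}`, supports `{σ, τ}`, polar formula
    have hpol₁ := polarDir_eq_of_level I hq
    -- indicator identities on basis vectors
    have hAdj : ∀ v w : Fin n, (if AndAdj I (B.D e₁) v w then (1 : ZMod 2) else 0) =
        (if AndAdj I (B.D e₂) v w then 1 else 0) + (if (v = σ ∧ w = τ) ∨ (v = τ ∧ w = σ) then 1 else 0) := fun v w => by
      have h := hpolar v w
      rw [hpol₁, polar_basis I hI hS] at h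
      exact h
    -- the mate `σ'` of `σ` in `j₁`
    obtain ⟨σ', hσ'j, hσσ'⟩ : ∃ σ' : Fin n, σ' ∈ andPair I j₁ ∧ σ' ≠ σ := by
      rcases (mem_andPair_iff I j₁ σ).1 hσ with h | h
      · exact ⟨I.vars j₁ 3, (mem_andPair_iff I j₁ _).2 (Or.inr rfl), fun e => and_ne I hI j₁ (h.symm.trans e.symm)⟩
      · exact ⟨I.vars j₁ 2, (mem_andPair_iff I j₁ _).2 (Or.inl rfl), fun e => and_ne I hI j₁ (e.trans h)⟩
    have hτσ : τ ≠ σ := fun h => Finset.disjoint_left.1 hdisj hσ (h ▸ hτ)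
    have hτσ' : τ ≠ σ' := fun h => Finset.disjoint_left.1 hdisj hσ'j (h ▸ hτ)
    -- `AndAdj (D e₂) v w` for `D e₂ = {j₁, j₂}`: only the two pairs
    have hAdj₂ : ∀ v w : Fin n, AndAdj I (B.D e₂) v w → (v ∈ andPair I j₁ ∧ w ∈ andPair I j₁) ∨ (v ∈ andPair I j₂ ∧ w ∈ andPair I j₂) := by
      rintro v w ⟨j, hj, hvw⟩
      rw [hDe₂, mem_insert, mem_singleton] at hj
      rcases hj with rfl | rfl
      · left
        rcases hvw with ⟨a, b⟩ | ⟨a, b⟩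
        · exact ⟨(mem_andPair_iff I _ _).2 (Or.inl a.symm), (mem_andPair_iff I _ _).2 (Or.inr b.symm)⟩
        · exact ⟨(mem_andPair_iff I _ _).2 (Or.inr b.symm), (mem_andPair_iff I _ _).2 (Or.inl a.symm)⟩
      · right
        rcases hvw with ⟨a, b⟩ | ⟨a, b⟩
        · exact ⟨(mem_andPair_iff I _ _).2 (Or.inl a.symm), (mem_andPair_iff I _ _).2 (Or.inr b.symm)⟩
        · exact ⟨(mem_andPair_iff I _ _).2 (Or.inr b.symm), (mem_andPair_iff I _ _).2 (Or.inl a.symm)⟩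
    have hστ₂ : ¬ AndAdj I (B.D e₂) σ τ := fun h => by
      rcases hAdj₂ σ τ h with ⟨-, hτ₁⟩ | ⟨hσ₂, -⟩
      · exact Finset.disjoint_left.1 hdisj hτ₁ hτ
      · exact Finset.disjoint_left.1 hdisj hσ hσ₂
    have hτσ'₂ : ¬ AndAdj I (B.D e₂) τ σ' := fun h => by
      rcases hAdj₂ τ σ' h with ⟨hτ₁, -⟩ | ⟨-, hσ'₂⟩
      · exact Finset.disjoint_left.1 hdisj hτ₁ hτ
      · exact Finset.disjoint_left.1 hdisj hσ'j hσ'₂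
    have hσσ'₂ : AndAdj I (B.D e₂) σ σ' := by
      refine ⟨j₁, by rw [hDe₂]; exact mem_insert_self _ _, ?_⟩
      rcases (mem_andPair_iff I j₁ σ).1 hσ with a | a <;> rcases (mem_andPair_iff I j₁ σ').1 hσ'j with b | b
      · exact absurd (b.trans a.symm) hσσ'
      · exact Or.inl ⟨a.symm, b.symm⟩
      · exact Or.inr ⟨b.symm, a.symm⟩
      · exact absurd (b.trans a.symm) hσσ'
    -- the three polar values of `D e₁` we need
    have hP₁στ : polar (K := ZMod 2) (B.D e₁) (fun j => I.vars j 2) (fun j => I.vars j 3) (Pi.single σ 1) (Pi.single τ 1) = 1 := by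
      rw [polar_basis I hI hS, hAdj, if_neg hστ₂, if_pos (Or.inl ⟨rfl, rfl⟩), zero_add]
    have hP₁σσ' : polar (K := ZMod 2) (B.D e₁) (fun j => I.vars j 2) (fun j => I.vars j 3) (Pi.single σ 1) (Pi.single σ' 1) = 1 := by
      rw [polar_basis I hI hS, hAdj, if_pos hσσ'₂, if_neg, add_zero]
      rintro (⟨-, h⟩ | ⟨h, -⟩)
      · exact hτσ' h.symm
      · exact hτσ h.symm
    have hP₁τσ' : polar (K := ZMod 2) (B.D e₁) (fun j => I.vars j 2) (fun j => I.vars j 3) (Pi.single τ 1) (Pi.single σ' 1) = 0 := by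
      rw [polar_basis I hI hS, hAdj, if_neg hτσ'₂, if_neg, add_zero]
      rintro (⟨h, -⟩ | ⟨-, h⟩)
      · exact hτσ h
      · exact hσσ' h
    have hP₂στ : polar (K := ZMod 2) (B.D e₂) (fun j => I.vars j 2) (fun j => I.vars j 3) (Pi.single σ 1) (Pi.single τ 1) = 0 := by
      rw [polar_basis I hI hS, if_neg hστ₂]
    -- values of `u₁`, `u₂` at `0`, `e_σ`, `e_τ`, `e_σ + e_τ`, `e_σ + e_τ + e_σ'`
    have hu0 : ∀ e, (sys I B).u e 0 = gam B e := fun e => by rw [sys_u_eq, PstarChordBridgeFlat.qform_zero, add_zero]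
    have hu1 : ∀ e (v : Fin n), (sys I B).u e (Pi.single v 1) = gam B e := fun e v => by
      rw [sys_u_eq, PstarChordBridgeFlat.qform_single I hI, add_zero]
    have hu₁στ : (sys I B).u e₁ (Pi.single σ 1 + Pi.single τ 1) = gam B e₁ + 1 := by
      rw [u_add I B e₁, hu1, hu1, hu0, hP₁στ]
      generalize gam B e₁ = g; revert g; decide
    have hu₂στ : (sys I B).u e₂ (Pi.single σ 1 + Pi.single τ 1) = gam B e₂ := by
      rw [u_add I B e₂, hu1, hu1, hu0, hP₂στ]
      generalize gam B e₂ = g; revert g; decide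
    have hu₁στσ' : (sys I B).u e₁ (Pi.single σ 1 + Pi.single τ 1 + Pi.single σ' 1) = gam B e₁ := by
      rw [u_add I B e₁, hu₁στ, hu1, hu0, map_add, LinearMap.add_apply, hP₁σσ', hP₁τσ']
      generalize gam B e₁ = g; revert g; decide
    -- the linear parts are supported on `{σ, τ}`: `σ'` is invisible
    have hσ'off : μ₁ (Pi.single σ' 1) = μ₁ 0 ∧ μ₂ (Pi.single σ' 1) = μ₂ 0 := by
      by_contra h
      rw [not_and_or] at h
      rcases (hsupp σ').1 h with e | e
      · exact hσσ' e
      · exact hτσ'.symm e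
    -- the product at the five points
    have hPt0 := hP 0
    have hPtσ := hP (Pi.single σ 1)
    have hPtτ := hP (Pi.single τ 1)
    have hPtστ := hP (Pi.single σ 1 + Pi.single τ 1)
    have hPtστσ' := hP (Pi.single σ 1 + Pi.single τ 1 + Pi.single σ' 1)
    rw [hu0, hu0] at hPt0
    rw [hu1, hu1] at hPtσ hPtτ
    rw [hu₂στ, hu₁στ, h₁ (Pi.single σ 1) (Pi.single τ 1), h₂ (Pi.single σ 1) (Pi.single τ 1)] at hPtστ
    have hu₂στσ' : (sys I B).u e₂ (Pi.single σ 1 + Pi.single τ 1 + Pi.single σ' 1) + (sys I B).u e₁ (Pi.single σ 1 + Pi.single τ 1 + Pi.single σ' 1) =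
        μ₁ (Pi.single σ 1 + Pi.single τ 1) * μ₂ (Pi.single σ 1 + Pi.single τ 1) := by
      rw [hPtστσ', h₁ (Pi.single σ 1 + Pi.single τ 1) (Pi.single σ' 1), h₂ (Pi.single σ 1 + Pi.single τ 1) (Pi.single σ' 1), hσ'off.1, hσ'off.2,
        h₁ (Pi.single σ 1) (Pi.single τ 1), h₂ (Pi.single σ 1) (Pi.single τ 1)]
      generalize μ₁ (Pi.single σ 1) = a; generalize μ₁ (Pi.single τ 1) = b; generalize μ₁ 0 = c
      generalize μ₂ (Pi.single σ 1) = a'; generalize μ₂ (Pi.single τ 1) = b'; generalize μ₂ 0 = c'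
      revert a b c a' b' c'; decide
    -- where `u_{e₁} = 1` the product vanishes; combine the five evaluations
    have hvan : ∀ x, (sys I B).u e₁ x = 1 → μ₁ x * μ₂ x = 0 := fun x hx => by rw [← hP x, hu₂ x hx, hx]; decide
    rcases e01 (gam B e₁) with g0 | g1
    · -- `γ₁ = 0`: the point `e_σ + e_τ` has `u₁ = 1`
      have hz := hvan (Pi.single σ 1 + Pi.single τ 1) (by rw [hu₁στ, g0]; decide)
      rw [h₁ (Pi.single σ 1) (Pi.single τ 1), h₂ (Pi.single σ 1) (Pi.single τ 1)] at hz
      rw [g0] at hPt0 hPtσ hPtτ hPtστ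
      revert hPt0 hPtσ hPtτ hPtστ hz
      generalize μ₁ (Pi.single σ 1) = a; generalize μ₁ (Pi.single τ 1) = b; generalize μ₁ 0 = c
      generalize μ₂ (Pi.single σ 1) = a'; generalize μ₂ (Pi.single τ 1) = b'; generalize μ₂ 0 = c'; generalize gam B e₂ = g
      revert a b c a' b' c' g; decide
    · -- `γ₁ = 1`: the point `e_σ + e_τ + e_σ'` has `u₁ = 1`
      have hz := hvan (Pi.single σ 1 + Pi.single τ 1 + Pi.single σ' 1) (by rw [hu₁στσ', g1])
      have hz' : μ₁ (Pi.single σ 1 + Pi.single τ 1) * μ₂ (Pi.single σ 1 + Pi.single τ 1) = 0 := by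
        rw [← hu₂στσ', hu₁στσ', g1]
        have h := hu₂ _ (by rw [hu₁στσ', g1] : (sys I B).u e₁ (Pi.single σ 1 + Pi.single τ 1 + Pi.single σ' 1) = 1)
        rw [h]; decide
      rw [h₁ (Pi.single σ 1) (Pi.single τ 1), h₂ (Pi.single σ 1) (Pi.single τ 1)] at hz'
      rw [g1] at hPt0 hPtσ hPtτ hPtστ
      clear hz
      revert hPt0 hPtσ hPtτ hPtστ hz'
      generalize μ₁ (Pi.single σ 1) = a; generalize μ₁ (Pi.single τ 1) = b; generalize μ₁ 0 = c
      generalize μ₂ (Pi.single σ 1) = a'; generalize μ₂ (Pi.single τ 1) = b'; generalize μ₂ 0 = c'; generalize gam B e₂ = g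
      revert a b c a' b' c' g; decide

end

end Summit.PneNP.PneNP.Theorems.PstarCrossNoCompanion
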